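import Summits.BirchSwinnertonDyer.BirchSwinnertonDyer.Theorems.QuadraticBranchSignedControlPlusEtaNonsurjPlusCoeffCongruenceQuotientMuCertificate
import Summits.BirchSwinnertonDyer.BirchSwinnertonDyer.Theorems.QuadraticBranchSignedControlPlusEtaNonsurjFineRoadCM
import Summits.BirchSwinnertonDyer.BirchSwinnertonDyer.Theorems.QuadraticBranchSignedControlPlusEtaNonsurjConjADoorHeckeFixedLine
import Literature.NumberTheory.EllipticCurves.ZywinaCMImageProofs
import Summits.BirchSwinnertonDyer.BirchSwinnertonDyer.Theorems.QuadraticBranchSignedControlPlusEtaNonsurjCMUnitRecordShape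
import Summits.BirchSwinnertonDyer.Rank1Residual.X12.InertCoreUpperHalf
import Summits.BirchSwinnertonDyer.Rank1Residual.X11b.KrausMinimalityGeneralTwo
import HarnessLib

/-!
# Route `QuadraticBranchSignedControl` (rung K8, cell `bsd-potss`), residual crux `PlusEtaMainConjectureNonsurj`
# (stmt-BirchSwinnertonDyer-19606): RECORDS E — THE CRUX'S CONCLUSION (C1⁺_η) `QuadraticBranchPlusEtaMainConjectureAt V 5` BY NAME on the 2
# in-table CM RANK-ONE partner rows with `λ⁺ = 5` (`78400gw1`, `435600ui1`) — the last in-table CM rank-one rows of g21's class «integral upper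
# inclusion only» without it, out of range of g25's moment certificate (`λ⁺ < p − 1`) — from g21's Hecke door L4 ((A) of the partner) and the NEW
# QUOTIENT certificate of `μ⁺ = 0` (seat `bsd-potss-k8eta-c2` g26; consumer of `…PlusCoeffCongruenceQuotientMuCertificate` (g26),
# `EtaFineRoad.etaMC_cmRows_of_bt26_of_conjA_of_analyticMu` (g6/g7), `EtaConjADoorHecke.conjA_partner_of_heckeEigenHom_auto` (g21); sequel of g25's RECORDS A–D)

WHY. v7's composition settles (C1⁺_η) on a CM row `V` (partner `W`, `C • W^{(5)} = V`) from THREE inputs modulo named facts: statement (A) of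
Coates–Sujatha at `(W,5)` (`stub_conjA_partners_cm`), the analytic `μ⁺ = 0` at `V` (`stub_analyticEtaMu_cm`), and Burungale–Tian Thm 2.6 (`h26`,
cite-level): `EtaFineRoad.etaMC_cmRows_of_bt26_of_conjA_of_analyticMu` (k8eta-c2 g7) — ANY rank, ANY shape of `L_5⁺`. g25's RECORDS A–D covered the
11 in-table CM rank-one rows with `λ⁺ = 3` through the MOMENT certificate `analyticEtaMu_row_of_mazurTate_padicNorm` (range `λ⁺ < p − 1 = 4`); the two
rows with `λ⁺ = 5` were out of its range. THIS FILE uses the QUOTIENT certificate `EtaPlusCoeffCongruence.analyticEtaMu_row_of_mazurTate_quotient_padicNorm`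
(g26, range `λ⁺ ≤ p(p−1) = 20`): `μ⁺(V) = 0 ∧ λ⁺ = 5` ⟸ «`‖ϖ·coeff_jℓ‖₅ ≤ 5⁻¹` (`j < 5`), `‖ϖ·coeff₅ℓ‖₅ = 1`» for the exact quotient
`ℓ = θ₂(η)/ω⁻₂ = θ₂(η)/Φ₅(1+X) ∈ ℚ[X]`; (A)(W,5) by g21's Hecke door L4 (`conjA_partner_of_heckeEigenHom_auto`: the Hecke-refined tautological eigen-test on
`Cl(𝓞_{ℚ(P)}) ⊗ 𝔽₅`, ONE displayed `∃P` datum, GRH); the CM binder from `j(W)` (decidable) transported to the twin (`X12.hasCM_of_smul_quadraticTwist`), the idle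
`¬ onto` binder from CM (Zywina).

WHAT. Per row `W` (literal Cremona minimal equation; CM with `j ∈ cmJInvariants`; `r_an(W) = 1`; twin `V` granted as ONE globally minimal good
`a_5 = 0` model of `W^{(5)}`, as in every record of this lineage): `isElliptic_<W>`, `isGloballyMinimal_<W>` (Kraus certificate, kernel) and
`etaMC_cm_r1_<W>_5_of_heckeEigen_of_quotient : … → QuadraticBranchPlusEtaMainConjectureAt V 5`. Named facts (hypothesis position): `h26`
(Burungale–Tian 2026 Thm 2.6, cite-level), `h22`, `h6273` (Kobayashi Thm 2.2 / 6.2–7.3 at `η`), `hM` (Mazur `p ∤ c₀`). DISPLAYED per row: the door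
datum `hP` (g21 census `E5-CLASSIFICATION-k8eta-c2-g21.tsv`: Hecke verdict TWIST, `c = 2`, `Tr = 2α = 3`; class numbers GRH) and the QUOTIENT pattern `hθ`
(λ⁺ + 1 = 6 exact rationals; kit j337693 of k8eta-c2 g26 = exact division of g25's kit-j337268 symbol polynomial `Σ_u (TH₂[u]/DEN₂)(1+X)^u` of the minimal
twin by `Φ₅(1+X)`, remainder `0`; table `P26-tabcm.tsv`, quoted per row; census P-26: the quotient reading equals PARI's `λ⁺` on 9091/9091 CM rows at
p = 5/7/11). CONVENTION-INVARIANCE: a change of generator of `Γ` (`X ↦ (1+X)^a − 1`, `5 ∤ a`), of the sign of `η`, or `u ↦ −u` multiplies `θ₂(η)` and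
`ω⁻₂` by units of `ℤ₅[X]/(ω₂)` compatible with the division, and `Ω_V⁺ ∈ {ω₁, 2ω₁}` rescales by a `5`-unit: the PATTERN (not the numbers) is invariant.

HONEST FRAMING (cell `bsd-potss`; FULL-BSD rank ≤ 1 programme, HUMAN RULING D-0036/D-0074): per-row RECORDS of the crux's conclusion at ONE row
each, CONDITIONAL on the named facts `h26 h22 h6273 hM` (h26 = a 2026 preprint-level cite binder of the route, exactly as in v7's `_of`) and on two
displayed per-row data (a GRH class-group computation; a quotient pattern = exact rational arithmetic on numerically recovered symbols — evidence, not
kernel facts); NO stub of 19606 is proved (the stubs are class-wide `∀`); `BSD(W,5)` for these rank-one rows would further need the route's open crux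
C-cc-1 (19116) — NOT claimed; crux and route OPEN; nothing booked. `--supports stmt-BirchSwinnertonDyer-19606`.

References: [BurungaleTian2026] Thm. 2.6, Rem. 2.7; [Kobayashi2003] Thm. 2.2 (p. 5), Thm. 3.2 (p. 7), §4 (p. 8), Thm. 6.2/6.3/7.3, Cor. 7.2 (p. 13);
[CoatesSujatha2005] §3 (A), Thm. 3.4, Lemma 3.8; [Pollack2003] Prop. 6.18; [Mazur1978] Cor. 4.1; [GreenbergVatsal2000] (2);
[SilvermanAEC2009] VII.1 Rem. 1.1, App. C §11; [Kraus1989]; [Cremona1997] Table 1.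
-/

set_option autoImplicit false
set_option linter.dupNamespace false

noncomputable section

open scoped Classical MatrixGroups ModularForm nonZeroDivisors

open CongruenceSubgroup NumberField Field WeierstrassCurve
open Literature.NumberTheory.EllipticCurves Literature.NumberTheory.EllipticCurves.ModularForms
  Literature.NumberTheory.EllipticCurves.Rank1Residual Literature.NumberTheory.EllipticCurves.Rank1Residual.Typed
  Literature.NumberTheory.GaloisRepresentations Literature.NumberTheory.GaloisCohomology Literature.NumberTheory.NumberFields
  Literature.NumberTheory.EllipticCurves.GreenbergVatsal2000 ZpExtension
  Literature.NumberTheory.EllipticCurves.Rank1Residual.X11RankOneCertificates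
open Summit.BirchSwinnertonDyer.Rank1Residual Summit.BirchSwinnertonDyer.Rank1Residual.Additive
  Summit.BirchSwinnertonDyer.Rank1Residual.X11b
open Summit.BirchSwinnertonDyer.BirchSwinnertonDyer.Theorems

namespace Summit.BirchSwinnertonDyer.BirchSwinnertonDyer.Theorems.EtaConjADoorEtaMCCMRecords

/-! ## Row `78400gw1` (CM, `j = -3375`, disc `-7`; `r_an(W) = 1`, `Tam(W) = 16`, `#Ш_an(W) = 1`; twin `N_V = 3136`; PARI `λ⁺ = 5`) -/

/-- `78400gw1` = `[0, 0, 0, -3500, 98000]`: `Δ = -1404928000000` `= ±2^18·5^6·7^3`, `Δ ≠ 0` (kernel). [cite: Cremona1997, Table 1 (label 78400gw1)] -/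
theorem isElliptic_78400gw1 : (⟨0, 0, 0, (-3500), 98000⟩ : WeierstrassCurve ℚ).IsElliptic :=
  isElliptic_of_discOf_ne_zero 0 0 0 (-3500) 98000 (by decide +kernel)

set_option maxRecDepth 100000 in
/-- `78400gw1` is a global minimal equation (Kraus criterion on the support of `Δ`, kernel). [cite: SilvermanAEC2009, VII.1 Remark 1.1] [cite: Kraus1989, Prop. 1–2] -/
theorem isGloballyMinimal_78400gw1 : (⟨0, 0, 0, (-3500), 98000⟩ : WeierstrassCurve ℚ).IsGloballyMinimal :=
  isGloballyMinimal_of_krausCriterion_support 0 0 0 (-3500) 98000 [(2, 0, 18), (5, 0, 6), (7, 0, 3)]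
    (by decide +kernel) (by decide +kernel) (by decide +kernel)

set_option maxRecDepth 100000 in
/-- **(C1⁺_η) — Kobayashi's even main conjecture at `η` for `(V, 5)`, the CRUX'S CONCLUSION — on the CM rank-one row `78400gw1`**
(`W = [0, 0, 0, -3500, 98000]`, `j = -3375` (CM by the order of discriminant `-7`), Cremona `r_an = 1`, `Tam = 16`; PARI plus-`η` `(λ, μ) = (5, 0)`;
k8eta-c2 g21 door census: `h(ℚ(P)) / h(ℚ(x(P))) = 10/1` (GRH), doors L6 and L6⁻ VOID, Hecke door L4 PASS (hecke13 verdict TWIST, `c = 2, Tr = 2α = 3`: the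
tautological class comes from the row curve, not from `W`)), for every globally minimal good `a_5 = 0` model `V` of `W^{(5)}` (minimal twin
`V = [0, 0, 0, -140, 784]`), from: named facts `h26 h22 h6273 hM`; DISPLAYED `hP` «the Hecke-refined tautological eigen-test on `Cl(𝓞_{ℚ(P)}) ⊗ 𝔽₅` for one `P ∈ W[5] ∖ 0`
(g21's `conjA_partner_of_heckeEigenHom_auto`, `hVH` discharged)»; DISPLAYED `hθ` «for the newform `f` of `V` and every period ratio `ϖ`, with
`ℓ = θ₂(η) /ₘ ω⁻₂` the exact quotient: `‖ϖ·coeff_jℓ‖₅ ≤ 5⁻¹` (`j < 5`), `‖ϖ·coeff₅ℓ‖₅ = 1`» — THE NUMBERS (kit j337693 over kit j337268's symbols, row `78400gw1`,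
minimal twin): `ℓ_0 = 0` (v₅ ∞), `ℓ_1 = 20` (v₅ 1), `ℓ_2 = 190` (v₅ 1), `ℓ_3 = 1030` (v₅ 1), `ℓ_4 = 3910` (v₅ 1), `ℓ_5 = 11426` (v₅ 0) — the registered `λ⁺ = 5` quotient pattern (g25's moment reading was one-sided `≥ 4` here).
Chain: (A)(W,5) by door L4H ∘ `μ⁺(V) = 0` by the QUOTIENT reading ∘ v7's CM composition `EtaFineRoad.etaMC_cmRows_of_bt26_of_conjA_of_analyticMu`.
CONDITIONAL; nothing booked; `BSD(W,5)` NOT claimed (needs C-cc-1). [cite: BurungaleTian2026, Thm. 2.6] [cite: Kobayashi2003, §4 (p. 8), Thm. 2.2, Thm. 7.3 i)]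
[cite: CoatesSujatha2005, §3 Thm. 3.4 and Lemma 3.8] [cite: Pollack2003, Prop. 6.18] [cite: Mazur1978, Cor. 4.1] [cite: Cremona1997, Table 1 (label 78400gw1)] -/
theorem etaMC_cm_r1_78400gw1_5_of_heckeEigen_of_quotient
    (h26 : BurungaleTian2026.thm26_etaKatoSequences_charIdeal_upToP_of_cm)
    (h22 : Kobayashi2003.thm22_etaSignedSelmerDual_finite_torsion)
    (h6273 : Kobayashi2003.thm62_63_73_etaColemanPoitouTate)
    (hM : mazur_not_dvd_maninConstant_of_odd) [Fact (5 : ℕ).Prime]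
    (W : WeierstrassCurve ℚ) (hW : W = (⟨0, 0, 0, (-3500), 98000⟩ : WeierstrassCurve ℚ))
    (V : WeierstrassCurve ℚ) [V.IsElliptic] [V.IsGloballyMinimal] (C : VariableChange ℚ)
    (hC : C • W.quadraticTwist 5 = V)
    (hgood : V.HasGoodReductionAtPrime 5) (hap : V.frobeniusTrace 5 = 0)
    (hP : haveI : W.IsElliptic := hW ▸ isElliptic_78400gw1
      haveI : NeZero (5 : ℕ) := ⟨by norm_num⟩
      haveI : NumberField (W.divisionField 5) := NumberField.mk
      ∃ P : geomTorsion W ((5 : ℕ) : ℤ), P ≠ 0 ∧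
        ∀ K : IntermediateField ℚ (W.divisionField 5),
          K = IntermediateField.fixedField
            ((MulAction.stabilizer (absoluteGaloisGroup ℚ) P).map (absRestrictNormalHom (W.divisionField 5))) →
        ∀ μ : Additive (ClassGroup (𝓞 K)) →+ ZMod 5,
          (∀ (τ : absoluteGaloisGroup ℚ) (σ : K ≃ₐ[ℚ] K) (a : ℕ),
              (∀ x : K, absRestrictNormalHom (W.divisionField 5) τ (x : W.divisionField 5) =
                ((σ x : K) : W.divisionField 5)) → τ • P = a • P →
              ∀ (I J : (Ideal (𝓞 K))⁰),
                (J : Ideal (𝓞 K)) = (I : Ideal (𝓞 K)).map (AmbiguousClass.intAut σ : 𝓞 K →+* 𝓞 K) →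
                μ (Additive.ofMul (ClassGroup.mk0 J)) = a • μ (Additive.ofMul (ClassGroup.mk0 I))) →
          (∀ (τ τ₁ : absoluteGaloisGroup ℚ) (a a₁ b : ℕ) (Q : geomTorsion W ((5 : ℕ) : ℤ)),
              τ • P = a • P + Q → τ₁ • P = a₁ • P → τ₁ • Q = b • Q → (a₁ : ZMod 5) ≠ (b : ZMod 5) →
              ∀ I : (Ideal (𝓞 K))⁰,
                μ (Additive.ofMul (classGroupNorm K (W.divisionField 5) (ClassGroup.mulEquiv
                  (AmbiguousClass.intAut (absRestrictNormalHom (W.divisionField 5) τ))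
                    (classGroupExtend K (W.divisionField 5) (ClassGroup.mk0 I))))) =
                  (Nat.card ((W.divisionField 5) ≃ₐ[K] (W.divisionField 5)) * a) •
                    μ (Additive.ofMul (ClassGroup.mk0 I))) →
          μ = 0)
    (hθ : ∀ {N : ℕ} [NeZero N] {f : CuspForm (Gamma0 N) 2}, IsNewformOf V f →
      ∀ (ϖ : ℚ), (if Even (5 / 2) then (ϖ : ℝ) * V.realPeriodRat = plusPeriod f
          else (ϖ : ℝ) * V.imaginaryPeriodRat = minusPeriod f) →
        (∀ j < 5, ‖(ϖ : ℚ_[5]) * (((quadraticBranchMazurTateElement 5 f (2 * 1) /ₘ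
            (cyclotomicOmegaMinus 5 (2 * 1)).map (Int.castRingHom ℚ)).coeff j : ℚ) : ℚ_[5])‖ ≤ (5 : ℝ)⁻¹) ∧
          ‖(ϖ : ℚ_[5]) * (((quadraticBranchMazurTateElement 5 f (2 * 1) /ₘ
            (cyclotomicOmegaMinus 5 (2 * 1)).map (Int.castRingHom ℚ)).coeff 5 : ℚ) : ℚ_[5])‖ = 1) :
    QuadraticBranchPlusEtaMainConjectureAt V 5 := by
  subst hW
  haveI : (⟨0, 0, 0, (-3500), 98000⟩ : WeierstrassCurve ℚ).IsElliptic := isElliptic_78400gw1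
  haveI : (⟨0, 0, 0, (-3500), 98000⟩ : WeierstrassCurve ℚ).IsGloballyMinimal := isGloballyMinimal_78400gw1
  haveI : NeZero (5 : ℕ) := ⟨by norm_num⟩
  have hD : ((-1 : ℚ) ^ ((5 : ℕ) / 2) * ((5 : ℕ) : ℚ)) = 5 := by norm_num
  have hC' : C • (⟨0, 0, 0, (-3500), 98000⟩ : WeierstrassCurve ℚ).quadraticTwist ((-1 : ℚ) ^ ((5 : ℕ) / 2) * ((5 : ℕ) : ℚ)) = V := by rw [hD]; exact hC
  have hj : (⟨0, 0, 0, (-3500), 98000⟩ : WeierstrassCurve ℚ).j = ((c4Of [0, 0, 0, (-3500), 98000] ^ 3 : ℤ) : ℚ) / ((discOf [0, 0, 0, (-3500), 98000] : ℤ) : ℚ) :=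
    @EtaUnitRows.ratCurve_j 0 0 0 (-3500) 98000 isElliptic_78400gw1
  have hCMW : (⟨0, 0, 0, (-3500), 98000⟩ : WeierstrassCurve ℚ).HasCM := (hasCM_iff_j_mem_holds _).mpr (by rw [hj]; decide +kernel)
  have hCMV : V.HasCM := X12.hasCM_of_smul_quadraticTwist _ hCMW (by norm_num : (5 : ℚ) ≠ 0) V C hC
  have hns : ¬ ∀ m : ℕ, V.HasSurjectiveModNGaloisRep (5 ^ m : ℕ) := fun h ↦
    V.not_hasSurjectiveModNGaloisRep_of_hasCM hCMV (ℓ := 5) (by norm_num) (by norm_num) (by simpa using h 1)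
  have hA := EtaConjADoorHecke.conjA_partner_of_heckeEigenHom_auto 5 V _ C (le_refl 5) hC' hgood hap hns hP
  exact EtaFineRoad.etaMC_cmRows_of_bt26_of_conjA_of_analyticMu h26 h22 h6273 V 5 (le_refl 5) hgood hap hns hCMV _ C hC' hA
    (fun hf ϖ hrel Lη hL ↦ EtaPlusCoeffCongruence.analyticEtaMu_row_of_mazurTate_quotient_padicNorm 5 hM (le_refl 5) V hgood hap 1
      le_rfl 5 (by norm_num) hθ hf ϖ hrel Lη hL)

/-! ## Row `435600ui1` (CM, `j = 0`, disc `-3`; `r_an(W) = 1`, `Tam(W) = 4`, `#Ш_an(W) = 1`; twin `N_V = 17424`; PARI `λ⁺ = 5`) -/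

/-- `435600ui1` = `[0, 0, 0, 0, -242000]`: `Δ = -25299648000000` `= ±2^12·3^3·5^6·11^4`, `Δ ≠ 0` (kernel). [cite: Cremona1997, Table 1 (label 435600ui1)] -/
theorem isElliptic_435600ui1 : (⟨0, 0, 0, 0, (-242000)⟩ : WeierstrassCurve ℚ).IsElliptic :=
  isElliptic_of_discOf_ne_zero 0 0 0 0 (-242000) (by decide +kernel)

set_option maxRecDepth 100000 in
/-- `435600ui1` is a global minimal equation (Kraus criterion on the support of `Δ`, kernel). [cite: SilvermanAEC2009, VII.1 Remark 1.1] [cite: Kraus1989, Prop. 1–2] -/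
theorem isGloballyMinimal_435600ui1 : (⟨0, 0, 0, 0, (-242000)⟩ : WeierstrassCurve ℚ).IsGloballyMinimal :=
  isGloballyMinimal_of_krausCriterion_support 0 0 0 0 (-242000) [(2, 0, 12), (3, 0, 3), (5, 0, 6), (11, 0, 4)]
    (by decide +kernel) (by decide +kernel) (by decide +kernel)

set_option maxRecDepth 100000 in
/-- **(C1⁺_η) — Kobayashi's even main conjecture at `η` for `(V, 5)`, the CRUX'S CONCLUSION — on the CM rank-one row `435600ui1`**
(`W = [0, 0, 0, 0, -242000]`, `j = 0` (CM by the order of discriminant `-3`), Cremona `r_an = 1`, `Tam = 4`; PARI plus-`η` `(λ, μ) = (5, 0)`;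
k8eta-c2 g21 door census: `h(ℚ(P)) / h(ℚ(x(P))) = 20/1` (GRH), doors L6 and L6⁻ VOID, Hecke door L4 PASS (hecke13 verdict TWIST, `c = 2, Tr = 2α = 3`: the
tautological class comes from the row curve, not from `W`)), for every globally minimal good `a_5 = 0` model `V` of `W^{(5)}` (minimal twin
`V = [0, 0, 0, 0, -1936]`), from: named facts `h26 h22 h6273 hM`; DISPLAYED `hP` «the Hecke-refined tautological eigen-test on `Cl(𝓞_{ℚ(P)}) ⊗ 𝔽₅` for one `P ∈ W[5] ∖ 0`
(g21's `conjA_partner_of_heckeEigenHom_auto`, `hVH` discharged)»; DISPLAYED `hθ` «for the newform `f` of `V` and every period ratio `ϖ`, with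
`ℓ = θ₂(η) /ₘ ω⁻₂` the exact quotient: `‖ϖ·coeff_jℓ‖₅ ≤ 5⁻¹` (`j < 5`), `‖ϖ·coeff₅ℓ‖₅ = 1`» — THE NUMBERS (kit j337693 over kit j337268's symbols, row `435600ui1`,
minimal twin): `ℓ_0 = 0` (v₅ ∞), `ℓ_1 = 15` (v₅ 1), `ℓ_2 = 285/2` (v₅ 1), `ℓ_3 = 915` (v₅ 1), `ℓ_4 = 3975` (v₅ 2), `ℓ_5 = 25853/2` (v₅ 0) — the registered `λ⁺ = 5` quotient pattern (g25's moment reading was one-sided `≥ 4` here).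
Chain: (A)(W,5) by door L4H ∘ `μ⁺(V) = 0` by the QUOTIENT reading ∘ v7's CM composition `EtaFineRoad.etaMC_cmRows_of_bt26_of_conjA_of_analyticMu`.
CONDITIONAL; nothing booked; `BSD(W,5)` NOT claimed (needs C-cc-1). [cite: BurungaleTian2026, Thm. 2.6] [cite: Kobayashi2003, §4 (p. 8), Thm. 2.2, Thm. 7.3 i)]
[cite: CoatesSujatha2005, §3 Thm. 3.4 and Lemma 3.8] [cite: Pollack2003, Prop. 6.18] [cite: Mazur1978, Cor. 4.1] [cite: Cremona1997, Table 1 (label 435600ui1)] -/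
theorem etaMC_cm_r1_435600ui1_5_of_heckeEigen_of_quotient
    (h26 : BurungaleTian2026.thm26_etaKatoSequences_charIdeal_upToP_of_cm)
    (h22 : Kobayashi2003.thm22_etaSignedSelmerDual_finite_torsion)
    (h6273 : Kobayashi2003.thm62_63_73_etaColemanPoitouTate)
    (hM : mazur_not_dvd_maninConstant_of_odd) [Fact (5 : ℕ).Prime]
    (W : WeierstrassCurve ℚ) (hW : W = (⟨0, 0, 0, 0, (-242000)⟩ : WeierstrassCurve ℚ))
    (V : WeierstrassCurve ℚ) [V.IsElliptic] [V.IsGloballyMinimal] (C : VariableChange ℚ)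
    (hC : C • W.quadraticTwist 5 = V)
    (hgood : V.HasGoodReductionAtPrime 5) (hap : V.frobeniusTrace 5 = 0)
    (hP : haveI : W.IsElliptic := hW ▸ isElliptic_435600ui1
      haveI : NeZero (5 : ℕ) := ⟨by norm_num⟩
      haveI : NumberField (W.divisionField 5) := NumberField.mk
      ∃ P : geomTorsion W ((5 : ℕ) : ℤ), P ≠ 0 ∧
        ∀ K : IntermediateField ℚ (W.divisionField 5),
          K = IntermediateField.fixedField
            ((MulAction.stabilizer (absoluteGaloisGroup ℚ) P).map (absRestrictNormalHom (W.divisionField 5))) →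
        ∀ μ : Additive (ClassGroup (𝓞 K)) →+ ZMod 5,
          (∀ (τ : absoluteGaloisGroup ℚ) (σ : K ≃ₐ[ℚ] K) (a : ℕ),
              (∀ x : K, absRestrictNormalHom (W.divisionField 5) τ (x : W.divisionField 5) =
                ((σ x : K) : W.divisionField 5)) → τ • P = a • P →
              ∀ (I J : (Ideal (𝓞 K))⁰),
                (J : Ideal (𝓞 K)) = (I : Ideal (𝓞 K)).map (AmbiguousClass.intAut σ : 𝓞 K →+* 𝓞 K) →
                μ (Additive.ofMul (ClassGroup.mk0 J)) = a • μ (Additive.ofMul (ClassGroup.mk0 I))) →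
          (∀ (τ τ₁ : absoluteGaloisGroup ℚ) (a a₁ b : ℕ) (Q : geomTorsion W ((5 : ℕ) : ℤ)),
              τ • P = a • P + Q → τ₁ • P = a₁ • P → τ₁ • Q = b • Q → (a₁ : ZMod 5) ≠ (b : ZMod 5) →
              ∀ I : (Ideal (𝓞 K))⁰,
                μ (Additive.ofMul (classGroupNorm K (W.divisionField 5) (ClassGroup.mulEquiv
                  (AmbiguousClass.intAut (absRestrictNormalHom (W.divisionField 5) τ))
                    (classGroupExtend K (W.divisionField 5) (ClassGroup.mk0 I))))) =
                  (Nat.card ((W.divisionField 5) ≃ₐ[K] (W.divisionField 5)) * a) •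
                    μ (Additive.ofMul (ClassGroup.mk0 I))) →
          μ = 0)
    (hθ : ∀ {N : ℕ} [NeZero N] {f : CuspForm (Gamma0 N) 2}, IsNewformOf V f →
      ∀ (ϖ : ℚ), (if Even (5 / 2) then (ϖ : ℝ) * V.realPeriodRat = plusPeriod f
          else (ϖ : ℝ) * V.imaginaryPeriodRat = minusPeriod f) →
        (∀ j < 5, ‖(ϖ : ℚ_[5]) * (((quadraticBranchMazurTateElement 5 f (2 * 1) /ₘ
            (cyclotomicOmegaMinus 5 (2 * 1)).map (Int.castRingHom ℚ)).coeff j : ℚ) : ℚ_[5])‖ ≤ (5 : ℝ)⁻¹) ∧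
          ‖(ϖ : ℚ_[5]) * (((quadraticBranchMazurTateElement 5 f (2 * 1) /ₘ
            (cyclotomicOmegaMinus 5 (2 * 1)).map (Int.castRingHom ℚ)).coeff 5 : ℚ) : ℚ_[5])‖ = 1) :
    QuadraticBranchPlusEtaMainConjectureAt V 5 := by
  subst hW
  haveI : (⟨0, 0, 0, 0, (-242000)⟩ : WeierstrassCurve ℚ).IsElliptic := isElliptic_435600ui1
  haveI : (⟨0, 0, 0, 0, (-242000)⟩ : WeierstrassCurve ℚ).IsGloballyMinimal := isGloballyMinimal_435600ui1
  haveI : NeZero (5 : ℕ) := ⟨by norm_num⟩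
  have hD : ((-1 : ℚ) ^ ((5 : ℕ) / 2) * ((5 : ℕ) : ℚ)) = 5 := by norm_num
  have hC' : C • (⟨0, 0, 0, 0, (-242000)⟩ : WeierstrassCurve ℚ).quadraticTwist ((-1 : ℚ) ^ ((5 : ℕ) / 2) * ((5 : ℕ) : ℚ)) = V := by rw [hD]; exact hC
  have hj : (⟨0, 0, 0, 0, (-242000)⟩ : WeierstrassCurve ℚ).j = ((c4Of [0, 0, 0, 0, (-242000)] ^ 3 : ℤ) : ℚ) / ((discOf [0, 0, 0, 0, (-242000)] : ℤ) : ℚ) :=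
    @EtaUnitRows.ratCurve_j 0 0 0 0 (-242000) isElliptic_435600ui1
  have hCMW : (⟨0, 0, 0, 0, (-242000)⟩ : WeierstrassCurve ℚ).HasCM := (hasCM_iff_j_mem_holds _).mpr (by rw [hj]; decide +kernel)
  have hCMV : V.HasCM := X12.hasCM_of_smul_quadraticTwist _ hCMW (by norm_num : (5 : ℚ) ≠ 0) V C hC
  have hns : ¬ ∀ m : ℕ, V.HasSurjectiveModNGaloisRep (5 ^ m : ℕ) := fun h ↦
    V.not_hasSurjectiveModNGaloisRep_of_hasCM hCMV (ℓ := 5) (by norm_num) (by norm_num) (by simpa using h 1)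
  have hA := EtaConjADoorHecke.conjA_partner_of_heckeEigenHom_auto 5 V _ C (le_refl 5) hC' hgood hap hns hP
  exact EtaFineRoad.etaMC_cmRows_of_bt26_of_conjA_of_analyticMu h26 h22 h6273 V 5 (le_refl 5) hgood hap hns hCMV _ C hC' hA
    (fun hf ϖ hrel Lη hL ↦ EtaPlusCoeffCongruence.analyticEtaMu_row_of_mazurTate_quotient_padicNorm 5 hM (le_refl 5) V hgood hap 1
      le_rfl 5 (by norm_num) hθ hf ϖ hrel Lη hL)

end Summit.BirchSwinnertonDyer.BirchSwinnertonDyer.Theorems.EtaConjADoorEtaMCCMRecords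

end
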